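import Mathlib.LinearAlgebra.Matrix.GeneralLinearGroup.Defs
import Mathlib.LinearAlgebra.Matrix.Block
import Mathlib.LinearAlgebra.Matrix.NonsingularInverse
import Mathlib.GroupTheory.Coset.Basic
import Mathlib.Topology.Algebra.InfiniteSum.Basic
import HarnessLib

/-!
# The mirabolic subgroup of `GL_c` and the orbit of the last row vector
(Cogdell, *Analytic theory of L-functions for GL_n*, in Bernstein–Gelbart (eds.), *An Introduction
to the Langlands Program* (2004), §1.1, proof of Thm. 1.1: "`P_n \ GL_n ≃ kⁿ - {0}`", §2.1 p. 200;
Jacquet–Shalika (1981), §4)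

Topic `LinearAlgebra/Matrix`; namespace `Literature.LinearAlgebra.Matrix`. Pure linear algebra over a
field `F` (Mathlib only), isolated for the Fourier–Whittaker expansion of cusp forms on `GL_n` along
the last column: the non-trivial characters `v ↦ ψ(ξ · v)`, `ξ ∈ F^c ∖ {0}`, of a column group
`F^c` form a single orbit under the corner subgroup `GL_c(F)` acting by `ξ ↦ ξ γ`, with stabiliser
the **mirabolic subgroup** `P_c = {γ : e_c γ = e_c}` (`e_c = (0, …, 0, 1)` the last row vector).

* `mirabolic c F ≤ GL_c(F)` (**definition**): the stabiliser `{γ | e ᵥ* γ = e}` of the row vector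
  `e = Pi.single (Fin.last _) 1` — the matrices whose last row is `(0, …, 0, 1)`;
  `mem_mirabolic_iff`, `mem_mirabolic_iff_row`.
* `lastRow γ = e ᵥ* γ` (the last row of `γ`); `lastRow_ne_zero`; `lastRow_mul_left_of_mem`
  (constant on right cosets `P γ`); `exists_lastRow_eq` (**transitivity**: every non-zero row
  vector is the last row of an invertible matrix); `lastRow_eq_lastRow_iff` (`⇔ γ' γ⁻¹ ∈ P`).
* `mirabolicQuotientEquiv` : `P_c \ GL_c(F) ≃ F^c ∖ {0}` (right cosets, Mathlib's
  `Quotient (QuotientGroup.rightRel P)`), and the resulting **re-indexing of sums**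
  `hasSum_mirabolicQuotient_iff` (`∑_{P γ} f(e γ) = ∑_{ξ ≠ 0} f(ξ)`).

## References

* J. W. Cogdell, *Analytic theory of L-functions for GL_n*, in J. Bernstein, S. Gelbart (eds.),
  *An Introduction to the Langlands Program*, Birkhäuser (2004), §1.1 (proof of Thm. 1.1), §2.1
  [CogdellAnalyticTheory2004].
-/

open scoped Matrix
open Function

namespace Literature.LinearAlgebra.Matrix

section Mirabolic

variable (c : ℕ) (F : Type*) [Field F]

/-- The last standard row vector `e = (0, …, 0, 1) ∈ F^{c+1}`. [folklore] -/
def lastVec : Fin (c + 1) → F := Pi.single (Fin.last c) 1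

/-- `e ≠ 0`. [folklore] -/
theorem lastVec_ne_zero : lastVec c F ≠ 0 := by
  intro h
  have := congr_fun h (Fin.last c)
  simp [lastVec] at this

variable {c F} in
/-- The **last row** `e ᵥ* γ` of an invertible matrix `γ ∈ GL_{c+1}(F)` (as a row vector). [folklore] -/
def lastRow (γ : GL (Fin (c + 1)) F) : Fin (c + 1) → F :=
  lastVec c F ᵥ* (γ : Matrix (Fin (c + 1)) (Fin (c + 1)) F)

variable {c F} in
/-- `lastRow γ = e ᵥ* γ` (definitional). [folklore] -/
theorem lastRow_def (γ : GL (Fin (c + 1)) F) :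
    lastRow γ = lastVec c F ᵥ* (γ : Matrix (Fin (c + 1)) (Fin (c + 1)) F) := rfl

variable {c F} in
/-- `lastRow γ j = γ (last) j`: it is the last row of the matrix. [folklore] -/
theorem lastRow_apply (γ : GL (Fin (c + 1)) F) (j : Fin (c + 1)) :
    lastRow γ j = (γ : Matrix (Fin (c + 1)) (Fin (c + 1)) F) (Fin.last c) j := by
  rw [lastRow_def, lastVec, Matrix.single_one_vecMul]
  rfl

variable {c F} in
/-- `lastRow (γ * γ') = lastRow γ ᵥ* γ'`. [folklore] -/
theorem lastRow_mul (γ γ' : GL (Fin (c + 1)) F) :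
    lastRow (γ * γ') = lastRow γ ᵥ* (γ' : Matrix (Fin (c + 1)) (Fin (c + 1)) F) := by
  rw [lastRow_def, lastRow_def, Units.val_mul, Matrix.vecMul_vecMul]

variable {c F} in
/-- `lastRow 1 = e`. [folklore] -/
@[simp]
theorem lastRow_one : lastRow (1 : GL (Fin (c + 1)) F) = lastVec c F := by
  rw [lastRow_def, Units.val_one, Matrix.vecMul_one]

variable {c F} in
/-- The last row of an invertible matrix is non-zero. [folklore] -/
theorem lastRow_ne_zero (γ : GL (Fin (c + 1)) F) : lastRow γ ≠ 0 := by
  intro h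
  have h1 : lastRow (γ * γ⁻¹) = 0 := by
    rw [lastRow_mul, h, Matrix.zero_vecMul]
  rw [mul_inv_cancel, lastRow_one] at h1
  exact lastVec_ne_zero c F h1

/-- The **mirabolic subgroup** `P_{c+1} ≤ GL_{c+1}(F)`: the stabiliser of the last row vector
`e = (0, …, 0, 1)` under `ξ ↦ ξ γ`, i.e. the invertible matrices with last row `(0, …, 0, 1)`
(Cogdell (2004), §2.1: "`P_n` … the stabiliser of the row vector `e_n`"; Jacquet–Shalika (1981),
§4). [cite: CogdellAnalyticTheory2004, §2.1] -/
def mirabolic : Subgroup (GL (Fin (c + 1)) F) where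
  carrier := {γ | lastRow γ = lastVec c F}
  one_mem' := lastRow_one
  mul_mem' {γ γ'} hγ hγ' := by
    change lastRow (γ * γ') = lastVec c F
    rw [lastRow_mul, hγ]
    exact hγ'
  inv_mem' {γ} hγ := by
    change lastRow γ⁻¹ = lastVec c F
    have h := lastRow_mul γ γ⁻¹
    rw [mul_inv_cancel, lastRow_one, hγ] at h
    exact h.symm

variable {c F} in
/-- Membership in the mirabolic: `γ ∈ P ↔ e ᵥ* γ = e`. [folklore] -/
theorem mem_mirabolic_iff {γ : GL (Fin (c + 1)) F} : γ ∈ mirabolic c F ↔ lastRow γ = lastVec c F :=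
  Iff.rfl

variable {c F} in
/-- Membership in the mirabolic in terms of entries: the last row is `(0, …, 0, 1)`. [folklore] -/
theorem mem_mirabolic_iff_row {γ : GL (Fin (c + 1)) F} :
    γ ∈ mirabolic c F ↔ ∀ j, (γ : Matrix (Fin (c + 1)) (Fin (c + 1)) F) (Fin.last c) j =
      if j = Fin.last c then 1 else 0 := by
  rw [mem_mirabolic_iff]
  constructor
  · intro h j
    rw [← lastRow_apply, h, lastVec, Pi.single_apply]
  · intro h
    funext j
    rw [lastRow_apply, h j, lastVec, Pi.single_apply]

variable {c F} in
/-- The last row is constant on right cosets of the mirabolic: `lastRow (p γ) = lastRow γ` for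
`p ∈ P`. [folklore] -/
theorem lastRow_mul_left_of_mem {p : GL (Fin (c + 1)) F} (hp : p ∈ mirabolic c F)
    (γ : GL (Fin (c + 1)) F) : lastRow (p * γ) = lastRow γ := by
  rw [lastRow_mul, mem_mirabolic_iff.1 hp, lastRow_def]

variable {c F} in
/-- `lastRow γ = lastRow γ' ↔ γ' γ⁻¹ ∈ P` (the fibres of `lastRow` are the right cosets of the
mirabolic). [folklore] -/
theorem lastRow_eq_lastRow_iff (γ γ' : GL (Fin (c + 1)) F) :
    lastRow γ = lastRow γ' ↔ γ' * γ⁻¹ ∈ mirabolic c F := by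
  rw [mem_mirabolic_iff, lastRow_mul]
  constructor
  · intro h
    rw [← h, ← lastRow_mul, mul_inv_cancel, lastRow_one]
  · intro h
    have h2 : lastRow γ' ᵥ* ((γ⁻¹ * γ : GL (Fin (c + 1)) F) : Matrix (Fin (c + 1)) (Fin (c + 1)) F) =
        lastVec c F ᵥ* (γ : Matrix (Fin (c + 1)) (Fin (c + 1)) F) := by
      rw [Units.val_mul, ← Matrix.vecMul_vecMul, h]
    rw [inv_mul_cancel, Units.val_one, Matrix.vecMul_one] at h2
    rw [h2, lastRow_def]

variable {c F} in
/-- **Transitivity**: every non-zero row vector `ξ ∈ F^{c+1}` is the last row of an invertible matrix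
(`P \ GL ≃ F^{c+1} ∖ {0}` is onto). Construction: if `ξ_{i₀} ≠ 0`, permute the columns of the
identity matrix with its last row replaced by `ξ ∘ σ`, `σ` the transposition `(i₀ last)`; that
matrix is lower triangular with diagonal `(1, …, 1, ξ_{i₀})`. [cite: CogdellAnalyticTheory2004, §2.1] -/
theorem exists_lastRow_eq {ξ : Fin (c + 1) → F} (hξ : ξ ≠ 0) :
    ∃ γ : GL (Fin (c + 1)) F, lastRow γ = ξ := by
  classical
  obtain ⟨i₀, hi₀⟩ : ∃ i, ξ i ≠ 0 := by
    by_contra h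
    push Not at h
    exact hξ (funext h)
  set σ : Equiv.Perm (Fin (c + 1)) := Equiv.swap i₀ (Fin.last c) with hσ
  -- the identity with last row replaced by `ξ ∘ σ`: lower triangular, determinant `ξ i₀`
  set M : Matrix (Fin (c + 1)) (Fin (c + 1)) F :=
    (1 : Matrix (Fin (c + 1)) (Fin (c + 1)) F).updateRow (Fin.last c) (ξ ∘ σ) with hM
  have hMlast : ∀ j, M (Fin.last c) j = ξ (σ j) := fun j => by
    rw [hM, Matrix.updateRow_self]; rfl
  have hMne : ∀ i, i ≠ Fin.last c → ∀ j, M i j = (1 : Matrix (Fin (c + 1)) (Fin (c + 1)) F) i j :=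
    fun i hi j => by rw [hM, Matrix.updateRow_ne hi]
  have hMtri : M.BlockTriangular OrderDual.toDual := by
    intro i j hij
    change OrderDual.toDual j < OrderDual.toDual i at hij
    rw [OrderDual.toDual_lt_toDual] at hij
    have hi : i ≠ Fin.last c := fun h => (Fin.le_last j).not_gt (h ▸ hij)
    rw [hMne i hi, Matrix.one_apply_ne (ne_of_lt hij)]
  have hMdet : M.det = ξ i₀ := by
    rw [Matrix.det_of_lowerTriangular M hMtri]
    rw [Fin.prod_univ_castSucc]
    have h1 : ∀ i : Fin c, M (Fin.castSucc i) (Fin.castSucc i) = 1 := fun i => by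
      rw [hMne _ (Fin.castSucc_lt_last i).ne, Matrix.one_apply_eq]
    simp only [h1, Finset.prod_const_one, one_mul, hMlast]
    rw [hσ, Equiv.swap_apply_right]
  -- permute the columns back
  set N : Matrix (Fin (c + 1)) (Fin (c + 1)) F := M.submatrix id σ with hN
  have hNdet : N.det ≠ 0 := by
    rw [hN, Matrix.det_permute', hMdet]
    exact mul_ne_zero (by
      rcases Int.units_eq_one_or (Equiv.Perm.sign σ) with h | h <;> simp [h]) hi₀
  refine ⟨Matrix.GeneralLinearGroup.mkOfDetNeZero N hNdet, funext fun j => ?_⟩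
  rw [lastRow_apply]
  change N (Fin.last c) j = ξ j
  rw [hN, Matrix.submatrix_apply, id, hMlast, hσ, Equiv.swap_apply_self]

/-- **`P \ GL_{c+1}(F) ≃ F^{c+1} ∖ {0}`** (Cogdell (2004), §2.1: "`P_n \ GL_n ≃ kⁿ - {0}`"): the
right cosets of the mirabolic correspond to the non-zero row vectors through `P γ ↦ e γ`.
[cite: CogdellAnalyticTheory2004, §2.1] -/
noncomputable def mirabolicQuotientEquiv :
    Quotient (QuotientGroup.rightRel (mirabolic c F)) ≃ {ξ : Fin (c + 1) → F // ξ ≠ 0} :=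
  Equiv.ofBijective
    (Quotient.lift (fun γ => (⟨lastRow γ, lastRow_ne_zero γ⟩ : {ξ : Fin (c + 1) → F // ξ ≠ 0}))
      (fun γ γ' h => by
        refine Subtype.ext ?_
        change lastRow γ = lastRow γ'
        exact (lastRow_eq_lastRow_iff γ γ').2 (QuotientGroup.rightRel_apply.mp h)))
    (by
      constructor
      · rintro ⟨γ⟩ ⟨γ'⟩ h
        have h' : lastRow γ = lastRow γ' := congrArg Subtype.val h
        exact Quotient.sound ((QuotientGroup.rightRel_apply).2 ((lastRow_eq_lastRow_iff γ γ').1 h'))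
      · rintro ⟨ξ, hξ⟩
        obtain ⟨γ, hγ⟩ := exists_lastRow_eq hξ
        exact ⟨Quotient.mk _ γ, Subtype.ext hγ⟩)

variable {c F} in
/-- The equivalence sends the coset of `γ` to `e ᵥ* γ`. [folklore] -/
@[simp]
theorem mirabolicQuotientEquiv_mk (γ : GL (Fin (c + 1)) F) :
    ((mirabolicQuotientEquiv c F (Quotient.mk _ γ) : {ξ : Fin (c + 1) → F // ξ ≠ 0}) :
      Fin (c + 1) → F) = lastRow γ :=
  rfl

variable {c F} in
/-- **Re-indexing sums over `P \ GL` as sums over non-zero row vectors**: for `f` on row vectors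
and a value `a`, `∑_{P γ} f(e γ)` converges to `a` iff `∑_{ξ ≠ 0} f(ξ)` does (the summand
`f (lastRow γ)` depends only on the right coset of `γ`). [folklore] -/
theorem hasSum_mirabolicQuotient_iff {M : Type*} [AddCommMonoid M] [TopologicalSpace M]
    (f : (Fin (c + 1) → F) → M) (a : M) :
    HasSum (fun q : Quotient (QuotientGroup.rightRel (mirabolic c F)) =>
      f ((mirabolicQuotientEquiv c F q : {ξ : Fin (c + 1) → F // ξ ≠ 0}) : Fin (c + 1) → F)) a ↔
      HasSum (fun ξ : {ξ : Fin (c + 1) → F // ξ ≠ 0} => f (ξ : Fin (c + 1) → F)) a :=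
  (mirabolicQuotientEquiv c F).hasSum_iff (f := fun ξ : {ξ : Fin (c + 1) → F // ξ ≠ 0} => f ξ)

variable {c F} in
/-- The same re-indexing written with representatives: `∑_{P γ} f(e ᵥ* γ)` where the summand is
evaluated at any representative (`Quotient.out`). [folklore] -/
theorem hasSum_lastRow_out_iff {M : Type*} [AddCommMonoid M] [TopologicalSpace M]
    (f : (Fin (c + 1) → F) → M) (a : M) :
    HasSum (fun q : Quotient (QuotientGroup.rightRel (mirabolic c F)) => f (lastRow q.out)) a ↔
      HasSum (fun ξ : {ξ : Fin (c + 1) → F // ξ ≠ 0} => f (ξ : Fin (c + 1) → F)) a := by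
  rw [← hasSum_mirabolicQuotient_iff]
  refine Iff.of_eq (congrArg (fun g => HasSum g a) (funext fun q => ?_))
  conv_rhs => rw [← Quotient.out_eq q]
  rfl

end Mirabolic

end Literature.LinearAlgebra.Matrix
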